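import Mathlib
import HarnessLib
import Summits.ValiantsHypothesis.ValiantsHypothesis.Theorems.MonotoneRestorationOrbitRestorationQPDepthThreeRungDefs
import Summits.ValiantsHypothesis.ValiantsHypothesis.Theorems.MonotoneRestorationQP.Negative.OrbitRestorationFalseOfPolylogWidthVP
import Summits.ValiantsHypothesis.ValiantsHypothesis.Theorems.MonotoneRestorationOrbitRestorationQPRungCalibration

/-!
# The kill instrument of EVERY rung of the product-depth ladder (crux `OrbitRestorationQP`, stmt-ValiantsHypothesis-18293,
# line `depth-three-rung`): a polylog-separating family INSIDE the class refutes `RestorationOn 𝒞`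

Namespace `Summit.ValiantsHypothesis.ValiantsHypothesis.Theorems.OrbitRestorationQPDepthThreeRung.RungKill`.  Definition-free.

The route's typed kill glue (`orbitRestorationQP_false_of_polylogWidthVP`, `…WidthKillsOrbitRestoration.lean`) refutes the
CRUX from a polylog-separating matrix-symmetric `VP` family.  The registered stubs of the line are WEAKER than the crux
(`OrbitRestorationQP → stub`, `onPath` in the skeleton), so `¬ crux` does not touch them: to kill the stub A_∞
(`stub_sigmaPiSigmaValue`) — or any rung `RestorationOn 𝒞` of the ladder — the separating family must lie IN THE CLASS `𝒞`.
The Dawar–Wilsenach orbit pipeline is per family and uses no complexity hypothesis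
(`not_qpOrbitSymmetric_of_polylogSeparating`), so this is immediate; we record it on the line's named vocabulary so that a
refuter of a stub knows exactly what to construct:

* `not_separating_of_qpOrbitRestorable` — a family restorable with one constant is NOT polylog-separating on simple graphs;
* `restorationOn_false_of_separating` — **for every class `𝒞`: a matrix-symmetric family lying in `𝒞 n c` (one `c`, all `n`)
  that is polylog-separating refutes `RestorationOn 𝒞`**; `productDepthRestorationQP_false_of_separating` — the rungs `δ`;
* (the instance `𝒞 = PDClass 1` — the registered stub A_∞ is refuted by a polylog-separating matrix-symmetric family with
  polynomial-size `ΣΠΣ` circuits — is already landed as `RungCalibration.sigmaPiSigmaValue_false_of_separating`; an `example`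
  records that it is this instance);
* `logDepthRestoration_false_of_separating` — the same for the limit stub `stub_logDepthRestoration` (product depth
  `c₀ (log₂ n + 1)`).

"Polylog-separating" is verbatim the separation clause of the route's construction item `PolylogWidthVP`: for every `c` and
beyond every `N` an order `m ≥ N` and two `≡^{C^{(log₂ m + c)^c}}`-equivalent simple graphs on `Fin m` whose `0/1` adjacency
matrices get different values of `f m`.  Honest label: bookkeeping over the landed pipeline; no such family is known inside
`ΣΠΣ` (the census of hands g3–g8 suggests polynomial orbits throughout the depth-three class); no stub closed; VP ≠ VNP untouched.
[cite: DawarWilsenach2025, Thm 5.1, Thms 6.2–6.4, §8; AndersonDawar2016, Thm 6]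
-/

noncomputable section

open scoped Classical

-- `Summit.ValiantsHypothesis.ValiantsHypothesis.…` is the tree's single-conjunct layout (Sub = Summit).
set_option linter.dupNamespace false

namespace Summit.ValiantsHypothesis.ValiantsHypothesis.Theorems.OrbitRestorationQPDepthThreeRung.RungKill

open MvPolynomial Literature.Computability.AlgebraicComplexity Literature.ModelTheory.FiniteModelTheory
  Summit.ValiantsHypothesis.ValiantsHypothesis.Theorems

/-- **Restorable families do not separate.**  If `f` is quasi-polynomially orbit-restorable with one constant, then `f` is not
polylog-separating on simple graphs. [cite: DawarWilsenach2025, Thm 5.1, Thms 6.2–6.4] -/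
theorem not_separating_of_qpOrbitRestorable (f : (n : ℕ) → MvPolynomial (Fin n × Fin n) ℂ)
    (hf : ∃ c : ℕ, ∀ n : ℕ, QPOrbitRestorable c n (f n)) :
    ¬ ∀ c N : ℕ, ∃ m : ℕ, N ≤ m ∧ ∃ X Y : SimpleGraph (Fin m),
        CkEquiv ((Nat.log 2 m + c) ^ c) X Y ∧
          MvPolynomial.eval (Set.indicator {ij : Fin m × Fin m | X.Adj ij.1 ij.2} 1) (f m) ≠
            MvPolynomial.eval (Set.indicator {ij : Fin m × Fin m | Y.Adj ij.1 ij.2} 1) (f m) :=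
  fun hsep => not_qpOrbitSymmetric_of_polylogSeparating f hsep hf

/-- **THE KILL INSTRUMENT OF A RUNG.**  For every class `𝒞`: a matrix-symmetric family lying in `𝒞 n c` for one `c` and all `n`
that is polylog-separating on simple graphs refutes `RestorationOn 𝒞`. [cite: DawarWilsenach2025, Thms 6.2–6.4, §8] -/
theorem restorationOn_false_of_separating (𝒞 : (n : ℕ) → ℕ → MvPolynomial (Fin n × Fin n) ℂ → Prop)
    (h : ∃ f : (n : ℕ) → MvPolynomial (Fin n × Fin n) ℂ, IsMatrixSymmetric f ∧ (∃ c : ℕ, ∀ n : ℕ, 𝒞 n c (f n)) ∧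
      ∀ c N : ℕ, ∃ m : ℕ, N ≤ m ∧ ∃ X Y : SimpleGraph (Fin m),
        CkEquiv ((Nat.log 2 m + c) ^ c) X Y ∧
          MvPolynomial.eval (Set.indicator {ij : Fin m × Fin m | X.Adj ij.1 ij.2} 1) (f m) ≠
            MvPolynomial.eval (Set.indicator {ij : Fin m × Fin m | Y.Adj ij.1 ij.2} 1) (f m)) :
    ¬ RestorationOn 𝒞 := by
  rintro hR
  obtain ⟨f, hsym, hC, hsep⟩ := h
  exact not_separating_of_qpOrbitRestorable f (hR f hsym hC) hsep

/-- The rungs of the product-depth ladder: a polylog-separating matrix-symmetric family in the slice `PDClass δ` refutes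
`ProductDepthRestorationQP δ`. [cite: DawarWilsenach2025, Thms 6.2–6.4, §8] -/
theorem productDepthRestorationQP_false_of_separating (δ : ℕ → ℕ)
    (h : ∃ f : (n : ℕ) → MvPolynomial (Fin n × Fin n) ℂ, IsMatrixSymmetric f ∧
      (∃ c : ℕ, ∀ n : ℕ, PDClass δ n c (f n)) ∧
      ∀ c N : ℕ, ∃ m : ℕ, N ≤ m ∧ ∃ X Y : SimpleGraph (Fin m),
        CkEquiv ((Nat.log 2 m + c) ^ c) X Y ∧
          MvPolynomial.eval (Set.indicator {ij : Fin m × Fin m | X.Adj ij.1 ij.2} 1) (f m) ≠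
            MvPolynomial.eval (Set.indicator {ij : Fin m × Fin m | Y.Adj ij.1 ij.2} 1) (f m)) :
    ¬ ProductDepthRestorationQP δ :=
  restorationOn_false_of_separating _ h

/-- The kill instrument of stub A_∞ (`stub_sigmaPiSigmaValue`) is LANDED as
`RungCalibration.sigmaPiSigmaValue_false_of_separating` (`…RungCalibration.lean`); here it is the instance `𝒞 = PDClass 1` of
`restorationOn_false_of_separating` (recorded as an example, not re-declared). [cite: DawarWilsenach2025, Thms 6.2–6.4, §8] -/
example
    (h : ∃ f : (n : ℕ) → MvPolynomial (Fin n × Fin n) ℂ, IsMatrixSymmetric f ∧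
      (∃ c : ℕ, ∀ n : ℕ, PDClass (fun _ => 1) n c (f n)) ∧
      ∀ c N : ℕ, ∃ m : ℕ, N ≤ m ∧ ∃ X Y : SimpleGraph (Fin m),
        CkEquiv ((Nat.log 2 m + c) ^ c) X Y ∧
          MvPolynomial.eval (Set.indicator {ij : Fin m × Fin m | X.Adj ij.1 ij.2} 1) (f m) ≠
            MvPolynomial.eval (Set.indicator {ij : Fin m × Fin m | Y.Adj ij.1 ij.2} 1) (f m)) :
    ¬ ∀ f : (n : ℕ) → MvPolynomial (Fin n × Fin n) ℂ, IsMatrixSymmetric f →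
      (∃ c : ℕ, ∀ n : ℕ, PDClass (fun _ => 1) n c (f n)) →
      ∃ c : ℕ, ∀ n : ℕ, QPOrbitRestorable c n (f n) :=
  RungCalibration.sigmaPiSigmaValue_false_of_separating h

/-- **THE KILL INSTRUMENT OF THE LIMIT STUB (`stub_logDepthRestoration`).**  A polylog-separating matrix-symmetric family in a
slice of product depth `c₀ (log₂ n + 1)` refutes the registered limit stub (conclusion = `¬` its signature verbatim).
[cite: DawarWilsenach2025, Thms 6.2–6.4, §8] -/
theorem logDepthRestoration_false_of_separating
    (h : ∃ (c₀ : ℕ) (f : (n : ℕ) → MvPolynomial (Fin n × Fin n) ℂ), IsMatrixSymmetric f ∧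
      (∃ c : ℕ, ∀ n : ℕ, PDClass (fun n => c₀ * (Nat.log 2 n + 1)) n c (f n)) ∧
      ∀ c N : ℕ, ∃ m : ℕ, N ≤ m ∧ ∃ X Y : SimpleGraph (Fin m),
        CkEquiv ((Nat.log 2 m + c) ^ c) X Y ∧
          MvPolynomial.eval (Set.indicator {ij : Fin m × Fin m | X.Adj ij.1 ij.2} 1) (f m) ≠
            MvPolynomial.eval (Set.indicator {ij : Fin m × Fin m | Y.Adj ij.1 ij.2} 1) (f m)) :
    ¬ ∀ c₀ : ℕ, ∀ f : (n : ℕ) → MvPolynomial (Fin n × Fin n) ℂ, IsMatrixSymmetric f →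
      (∃ c : ℕ, ∀ n : ℕ, PDClass (fun n => c₀ * (Nat.log 2 n + 1)) n c (f n)) →
      ∃ c : ℕ, ∀ n : ℕ, QPOrbitRestorable c n (f n) := by
  rintro hL
  obtain ⟨c₀, h⟩ := h
  exact restorationOn_false_of_separating _ h (hL c₀)

end Summit.ValiantsHypothesis.ValiantsHypothesis.Theorems.OrbitRestorationQPDepthThreeRung.RungKill

end
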